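import Mathlib
import HarnessLib
import Summits.RiemannHypothesis.RiemannHypothesis.Theorems.IntegerScrewRoughPart
import Summits.RiemannHypothesis.RiemannHypothesis.Theorems.IntegerScrewMartingaleStep

/-!
# Route `IntegerScrew` — the top-down martingale of CONTINUUM-LIMIT §24 assembled (PROPOSITION T's skeleton)

For the harmonic weights `1/x` on `{1,…,M}` and any `g : ℕ → ℝ`, reveal the prime coordinates of `x` from the
largest prime down: the keys `roughPart N` (`IntegerScrewRoughPart`), `N = M+1, …, 2`, give a chain of
partitions from one atom to points, and the law of total variance (`IntegerScrewVarianceDecomp`) telescopes: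

* `withinVar_succ_eq` — `V_{N+1} = V_N + B_N` (`V_N` = within-variance of the `roughPart N`-partition,
  `B_N` = the between term); `withinVar_two`, `withinVar_top` — `V_2 = 0`, `V_{M+1} = Σ (1/x)(g x − ḡ)²`;
  `betweenVar_eq_zero_of_not_prime` — `B_N = 0` unless `N` is prime; hence
  **`variance_eq_sum_between`**: `Σ_{x≤M} (1/x)(g x − ḡ)² = Σ_{p ≤ M prime} B_p` (§24.3's `Var = Σ_k T_k`);
* `betweenVar_prime_eq` — for a prime `p`, `B_p = Σ_u BFV_p(A_u)` over the atoms `A_u = {x ≤ M : roughPart (p+1) x = u}`,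
  where `BFV_p` is the between-fibre variance of `IntegerScrewMartingaleStep.between_fibre_variance_le`;
* **`variance_le_main_add_room`** — hence, for every `θ > 0`,
  `Σ_{x≤M}(1/x)(g x − ḡ)² ≤ (1+θ)·Σ_{p≤M} Σ_{x≤M}(1/x)Σ_{d=1}^{v_p x}(g x − g(x/p^d))² + (1+1/θ)·ROOM(g)`,
  with `ROOM(g)` the explicit sum of the atoms' window terms;
* `log_two_mul_main_le_dirichlet` — `log 2 · MAIN ≤ D(g)` (Dirichlet form in prime-power form);
* **`variance_le_of_room_le`** — PROPOSITION T of §24.3: `ROOM ≤ B·D ⇒ log 2·Σ(1/x)(g x − ḡ)² ≤ ((1+θ)+(1+1/θ)B log 2)·D`;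
* **`variance_le_of_atom_room_le`** — THEOREM P₀'s transfer structure: if every atom's ROOM term is at most `s p`
  times the atom's own Dirichlet form (deaths by primes `< p`), then
  `log 2·Σ(1/x)(g x − ḡ)² ≤ ((1+θ)+(1+1/θ)(Σ_{p≤M} s p) log 2)·D` — the only thing between this and a uniform
  spectral gap is the window law (CONJECTURE W of §24: `Σ_p s p` bounded uniformly in `M`).

RH-free; pure bookkeeping on top of the two generic files.

References: CONTINUUM-LIMIT §24 (rh-explicit A6-PIVOT); M. Suzuki, J. Lond. Math. Soc. (2) 108 (2023) 1448–1487
[Suzuki2023].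
-/

noncomputable section

set_option linter.dupNamespace false -- D-0017: `Summit.<S>.<S>.…` is the designed namespace

namespace Summit.RiemannHypothesis.RiemannHypothesis.Theorems.IntegerScrew

open Finset

set_option quotPrecheck false in
/-- Fibre mean of `g` at level `N` (key value `k`), harmonic weights on `{1,…,M}`. -/
local notation "μ[" M "," N "," g "]" => fun k : ℕ =>
  (∑ y ∈ Finset.filter (fun y : ℕ => roughPart N y = k) (Finset.Icc 1 M), 1 / (y : ℝ) * g y) /
    (∑ y ∈ Finset.filter (fun y : ℕ => roughPart N y = k) (Finset.Icc 1 M), 1 / (y : ℝ))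

set_option quotPrecheck false in
/-- Within-variance of the level-`N` partition. -/
local notation "V[" M "," N "," g "]" =>
  ∑ x ∈ Finset.Icc 1 M, 1 / (x : ℝ) * (g x - (μ[M, N, g]) (roughPart N x)) ^ 2

set_option quotPrecheck false in
/-- Between term of the levels `N ≤ N+1`. -/
local notation "B[" M "," N "," g "]" =>
  ∑ x ∈ Finset.Icc 1 M, 1 / (x : ℝ) * ((μ[M, N, g]) (roughPart N x) - (μ[M, N + 1, g]) (roughPart (N + 1) x)) ^ 2

/-! ### The law of total variance along the chain of keys -/

/-- The fibre-mean property of `μ[M,N,g]` (every fibre of `{1,…,M}` has positive weight or is empty). -/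
theorem fibreMean_property (M N : ℕ) (g : ℕ → ℝ) (k : ℕ) :
    ∑ x ∈ Icc 1 M with roughPart N x = k, 1 / (x : ℝ) * (g x - (μ[M, N, g]) k) = 0 := by
  by_cases hW : ∑ y ∈ (Icc 1 M).filter (fun y => roughPart N y = k), 1 / (y : ℝ) = 0
  · -- empty fibre (all weights are positive)
    have hempty : (Icc 1 M).filter (fun y => roughPart N y = k) = ∅ := by
      by_contra hne
      obtain ⟨y, hy⟩ := Finset.nonempty_iff_ne_empty.2 hne
      have hpos : 0 < ∑ y ∈ (Icc 1 M).filter (fun y => roughPart N y = k), 1 / (y : ℝ) :=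
        Finset.sum_pos (fun z hz => by
          have := (mem_Icc.1 (mem_filter.1 hz).1).1; positivity) ⟨y, hy⟩
      linarith
    rw [hempty, Finset.sum_empty]
  · exact fibre_mean_property (Icc 1 M) (fun x => 1 / (x : ℝ)) g (roughPart N) k hW

/-- **`V_{N+1} = V_N + B_N`.** -/
theorem withinVar_succ_eq (M N : ℕ) (g : ℕ → ℝ) : V[M, N + 1, g] = V[M, N, g] + B[M, N, g] := by
  have h := sum_mul_sq_sub_eq_within_add_between (Icc 1 M) (fun x => 1 / (x : ℝ)) g (roughPart N)
    (μ[M, N, g]) (fun k => (μ[M, N + 1, g]) (roughPart (N + 1) k)) (fibreMean_property M N g)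
  -- `n (roughPart N x) = μ_{N+1} (roughPart (N+1) x)` since `roughPart (N+1) (roughPart N x) = roughPart (N+1) x`
  simp only [roughPart_roughPart (Nat.le_succ N)] at h
  exact h

/-- **`V_2 = 0`**: the level-`2` partition is into points. -/
theorem withinVar_two (M : ℕ) (g : ℕ → ℝ) : V[M, 2, g] = 0 := by
  refine Finset.sum_eq_zero fun x hx => ?_
  have hx1 : 1 ≤ x := (mem_Icc.1 hx).1
  have hx0 : x ≠ 0 := by omega
  have hfib : (Icc 1 M).filter (fun y => roughPart 2 y = roughPart 2 x) = {x} := by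
    ext y
    simp only [mem_filter, mem_singleton]
    constructor
    · rintro ⟨hy, hyx⟩
      have hy0 : y ≠ 0 := by have := (mem_Icc.1 hy).1; omega
      rwa [roughPart_two hy0, roughPart_two hx0] at hyx
    · rintro rfl; exact ⟨hx, rfl⟩
  have hxpos : (0 : ℝ) < x := by exact_mod_cast hx1
  simp only [hfib, Finset.sum_singleton]
  have hmean : (1 / (x : ℝ) * g x) / (1 / (x : ℝ)) = g x := by field_simp
  rw [hmean, sub_self]
  ring

/-- **`V_{M+1} = Σ (1/x)(g x − ḡ)²`**: the level-`(M+1)` partition is trivial. -/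
theorem withinVar_top (M : ℕ) (g : ℕ → ℝ) :
    V[M, M + 1, g] =
      ∑ x ∈ Icc 1 M, 1 / (x : ℝ) *
        (g x - (∑ y ∈ Icc 1 M, 1 / (y : ℝ) * g y) / (∑ y ∈ Icc 1 M, 1 / (y : ℝ))) ^ 2 := by
  refine Finset.sum_congr rfl fun x hx => ?_
  have hxM : x ≤ M := (mem_Icc.1 hx).2
  have hfib : (Icc 1 M).filter (fun y => roughPart (M + 1) y = roughPart (M + 1) x) = Icc 1 M := by
    ext y
    simp only [mem_filter, and_iff_left_iff_imp]
    intro hy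
    rw [roughPart_eq_one_of_le (show y < M + 1 by have := (mem_Icc.1 hy).2; omega),
      roughPart_eq_one_of_le (show x < M + 1 by omega)]
  simp only [hfib]

/-- **`B_N = 0` unless `N` is prime.** -/
theorem betweenVar_eq_zero_of_not_prime (M : ℕ) {N : ℕ} (hN : ¬ N.Prime) (g : ℕ → ℝ) : B[M, N, g] = 0 := by
  have hkey : roughPart N = roughPart (N + 1) := funext fun x => roughPart_succ_of_not_prime hN x
  refine Finset.sum_eq_zero fun x _ => ?_
  simp only [hkey, sub_self, zero_pow two_ne_zero, mul_zero]

/-- Telescoping: `V_K = V_2 + Σ_{N ∈ [2,K)} B_N` for `K ≥ 2`. -/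
theorem withinVar_eq_sum_between (M : ℕ) (g : ℕ → ℝ) {K : ℕ} (hK : 2 ≤ K) :
    V[M, K, g] = V[M, 2, g] + ∑ N ∈ Ico 2 K, B[M, N, g] := by
  induction K, hK using Nat.le_induction with
  | base => simp
  | succ K hK ih => rw [Finset.sum_Ico_succ_top hK, ← add_assoc, ← ih, withinVar_succ_eq]

/-- **The variance is the sum of the between terms over the PRIMES `≤ M`** (CONTINUUM-LIMIT §24.3: `Var = Σ_k T_k`). -/
theorem variance_eq_sum_between (M : ℕ) (g : ℕ → ℝ) :
    ∑ x ∈ Icc 1 M, 1 / (x : ℝ) *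
        (g x - (∑ y ∈ Icc 1 M, 1 / (y : ℝ) * g y) / (∑ y ∈ Icc 1 M, 1 / (y : ℝ))) ^ 2 =
      ∑ p ∈ (Ico 2 (M + 1)).filter Nat.Prime, B[M, p, g] := by
  rcases Nat.eq_zero_or_pos M with rfl | hM
  · simp
  rw [← withinVar_top, withinVar_eq_sum_between M g (by omega : 2 ≤ M + 1), withinVar_two, zero_add,
    Finset.sum_filter]
  refine Finset.sum_congr rfl fun N _ => ?_
  split_ifs with h
  · rfl
  · exact betweenVar_eq_zero_of_not_prime M h g

/-! ### The between term at a prime is the sum of the atoms' between-fibre variances -/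

/-- The atoms of level `p+1` are closed under division by `p`. -/
theorem atom_div_mem {M p u x : ℕ} (hp : p.Prime)
    (hx : x ∈ (Icc 1 M).filter (fun y => roughPart (p + 1) y = u)) (hpx : p ∣ x) :
    x / p ∈ (Icc 1 M).filter (fun y => roughPart (p + 1) y = u) := by
  obtain ⟨hxI, hxu⟩ := mem_filter.1 hx
  have hx1 : 1 ≤ x := (mem_Icc.1 hxI).1
  refine mem_filter.2 ⟨mem_Icc.2 ⟨?_, (Nat.div_le_self x p).trans (mem_Icc.1 hxI).2⟩, ?_⟩
  · exact Nat.div_pos (Nat.le_of_dvd (by omega) hpx) hp.pos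
  · have h := roughPart_succ_div_pow (x := x) (d := 1) hp (by simpa using hpx)
    rw [pow_one] at h
    rw [h, hxu]

/-- For `x` in the atom `A_u` with `v_p(x) = v`, the level-`p` fibre of `x` inside `{1,…,M}` is exactly
`{y ∈ A_u : v_p(y) = v}`. -/
theorem fibre_roughPart_prime_eq {M p u v x : ℕ} (hp : p.Prime)
    (hx : x ∈ ((Icc 1 M).filter (fun y => roughPart (p + 1) y = u)).filter (fun y => y.factorization p = v)) :
    (Icc 1 M).filter (fun y => roughPart p y = roughPart p x) =
      ((Icc 1 M).filter (fun y => roughPart (p + 1) y = u)).filter (fun y => y.factorization p = v) := by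
  obtain ⟨hxA, hxv⟩ := mem_filter.1 hx
  obtain ⟨hxI, hxu⟩ := mem_filter.1 hxA
  ext y
  simp only [mem_filter, roughPart_prime_eq_iff hp y x, hxu, hxv, and_assoc]

/-- **`B_p = Σ_u BFV_p(A_u)`**: at a prime `p` the between term is the sum over the atoms
`A_u = {x ≤ M : roughPart (p+1) x = u}` of their between-fibre variances (the left-hand side of
`between_fibre_variance_le`). -/
theorem betweenVar_prime_eq (M : ℕ) {p : ℕ} (hp : p.Prime) (g : ℕ → ℝ) :
    B[M, p, g] =
      ∑ u ∈ (Icc 1 M).image (fun x => roughPart (p + 1) x),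
        ∑ v ∈ ((Icc 1 M).filter (fun y => roughPart (p + 1) y = u)).image (fun a => a.factorization p),
          (∑ a ∈ ((Icc 1 M).filter (fun y => roughPart (p + 1) y = u)) with a.factorization p = v, 1 / (a : ℝ)) *
            ((∑ a ∈ ((Icc 1 M).filter (fun y => roughPart (p + 1) y = u)) with a.factorization p = v,
                  1 / (a : ℝ) * g a) /
                (∑ a ∈ ((Icc 1 M).filter (fun y => roughPart (p + 1) y = u)) with a.factorization p = v,
                  1 / (a : ℝ)) -
              (∑ a ∈ (Icc 1 M).filter (fun y => roughPart (p + 1) y = u), 1 / (a : ℝ) * g a) /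
                (∑ a ∈ (Icc 1 M).filter (fun y => roughPart (p + 1) y = u), 1 / (a : ℝ))) ^ 2 := by
  -- group by u, then by v
  have hmapsU : ∀ x ∈ Icc 1 M, roughPart (p + 1) x ∈ (Icc 1 M).image (fun x => roughPart (p + 1) x) :=
    fun x hx => mem_image_of_mem _ hx
  rw [← Finset.sum_fiberwise_of_maps_to hmapsU]
  refine Finset.sum_congr rfl fun u _ => ?_
  set A := (Icc 1 M).filter (fun y => roughPart (p + 1) y = u) with hA
  have hmapsV : ∀ x ∈ A, x.factorization p ∈ A.image (fun a => a.factorization p) :=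
    fun x hx => mem_image_of_mem _ hx
  rw [← Finset.sum_fiberwise_of_maps_to hmapsV]
  refine Finset.sum_congr rfl fun v _ => ?_
  -- on the (u,v)-cell both means are constants
  rw [Finset.sum_mul]
  refine Finset.sum_congr rfl fun x hx => ?_
  have hfib := fibre_roughPart_prime_eq (M := M) hp hx
  have hxu : roughPart (p + 1) x = u := (mem_filter.1 (mem_filter.1 hx).1).2
  simp only [hfib, hxu, hA]

/-! ### The assembled inequality (PROPOSITION T's skeleton) -/

/-- **The top-down martingale bound (CONTINUUM-LIMIT §24.3, PROP. T's skeleton).**  For every `M`, `g` and `θ > 0`: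
`Σ_{x≤M} (1/x)(g x − ḡ)² ≤ (1+θ)·Σ_{p ≤ M prime} Σ_{x≤M} (1/x) Σ_{d=1}^{v_p x} (g x − g(x/p^d))² + (1+1/θ)·ROOM(g)`,
`ḡ` the harmonic mean, `ROOM(g)` the sum over the primes `p ≤ M`, the atoms `A_u = {x ≤ M : roughPart (p+1) x = u}`
and the pairs of `p`-fibres `w < v` of `A_u` of `W_v · (avg_{fib w} g − avg_{fib w, fits at level v} g)²`.  The MAIN
double sum is `≤ D(g)/log 2` (`D` the Dirichlet form in prime-power form, since `log 2 ≤ log p`); a bound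
`ROOM ≤ B·D` (the window law) would give the uniform Poincaré inequality `Var ≤ ((1+θ)/log 2 + (1+1/θ)B)·D`. -/
theorem variance_le_main_add_room (M : ℕ) (g : ℕ → ℝ) {θ : ℝ} (hθ : 0 < θ) :
    ∑ x ∈ Icc 1 M, 1 / (x : ℝ) *
        (g x - (∑ y ∈ Icc 1 M, 1 / (y : ℝ) * g y) / (∑ y ∈ Icc 1 M, 1 / (y : ℝ))) ^ 2 ≤
      (1 + θ) * ∑ p ∈ (Ico 2 (M + 1)).filter Nat.Prime,
          ∑ x ∈ Icc 1 M, 1 / (x : ℝ) * ∑ d ∈ Icc 1 (x.factorization p), (g x - g (x / p ^ d)) ^ 2 +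
      (1 + 1 / θ) * ∑ p ∈ (Ico 2 (M + 1)).filter Nat.Prime,
        ∑ u ∈ (Icc 1 M).image (fun x => roughPart (p + 1) x),
          ∑ v ∈ ((Icc 1 M).filter (fun y => roughPart (p + 1) y = u)).image (fun a => a.factorization p),
            ∑ w ∈ ((Icc 1 M).filter (fun y => roughPart (p + 1) y = u)).image (fun a => a.factorization p)
              with w < v,
              (∑ a ∈ ((Icc 1 M).filter (fun y => roughPart (p + 1) y = u)) with a.factorization p = v,
                  1 / (a : ℝ)) *
                ((∑ a ∈ ((Icc 1 M).filter (fun y => roughPart (p + 1) y = u)) with a.factorization p = w,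
                      1 / (a : ℝ) * g a) /
                    (∑ a ∈ ((Icc 1 M).filter (fun y => roughPart (p + 1) y = u)) with a.factorization p = w,
                      1 / (a : ℝ)) -
                  (∑ a ∈ (((Icc 1 M).filter (fun y => roughPart (p + 1) y = u)).filter
                      (fun a => a.factorization p = w)) with
                        a * p ^ (v - w) ∈ (Icc 1 M).filter (fun y => roughPart (p + 1) y = u),
                      1 / (a : ℝ) * g a) /
                    (∑ a ∈ (((Icc 1 M).filter (fun y => roughPart (p + 1) y = u)).filter
                      (fun a => a.factorization p = w)) with
                        a * p ^ (v - w) ∈ (Icc 1 M).filter (fun y => roughPart (p + 1) y = u),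
                      1 / (a : ℝ))) ^ 2 := by
  rw [variance_eq_sum_between, Finset.mul_sum, Finset.mul_sum, ← Finset.sum_add_distrib]
  refine Finset.sum_le_sum fun p hpP => ?_
  have hp : p.Prime := (mem_filter.1 hpP).2
  rw [betweenVar_prime_eq M hp g]
  -- Σ_u MAIN(A_u) = the MAIN sum over {1,…,M}
  have hmapsU : ∀ x ∈ Icc 1 M, roughPart (p + 1) x ∈ (Icc 1 M).image (fun x => roughPart (p + 1) x) :=
    fun x hx => mem_image_of_mem _ hx
  rw [← Finset.sum_fiberwise_of_maps_to hmapsU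
    (fun x => 1 / (x : ℝ) * ∑ d ∈ Icc 1 (x.factorization p), (g x - g (x / p ^ d)) ^ 2),
    Finset.mul_sum, Finset.mul_sum, ← Finset.sum_add_distrib]
  refine Finset.sum_le_sum fun u _ => ?_
  -- the atom is a finite set of positive integers closed under division by p
  have hS : ∀ a ∈ (Icc 1 M).filter (fun y => roughPart (p + 1) y = u), 1 ≤ a :=
    fun a ha => (mem_Icc.1 (mem_filter.1 ha).1).1
  have hdiv : ∀ a ∈ (Icc 1 M).filter (fun y => roughPart (p + 1) y = u), p ∣ a →
      a / p ∈ (Icc 1 M).filter (fun y => roughPart (p + 1) y = u) :=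
    fun a ha hpa => atom_div_mem hp ha hpa
  exact between_fibre_variance_le hp hS hdiv g hθ

/-- **MAIN ≤ D/log 2**: the MAIN double sum is at most `1/log 2` times the Dirichlet form in prime-power form
`D(g) = Σ_{p ≤ M prime} Σ_{x ≤ M} (1/x) Σ_{d=1}^{v_p x} log p·(g x − g(x/p^d))²` (`log 2 ≤ log p`). -/
theorem log_two_mul_main_le_dirichlet (M : ℕ) (g : ℕ → ℝ) :
    Real.log 2 * ∑ p ∈ (Ico 2 (M + 1)).filter Nat.Prime,
        ∑ x ∈ Icc 1 M, 1 / (x : ℝ) * ∑ d ∈ Icc 1 (x.factorization p), (g x - g (x / p ^ d)) ^ 2 ≤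
      ∑ p ∈ (Ico 2 (M + 1)).filter Nat.Prime,
        ∑ x ∈ Icc 1 M, 1 / (x : ℝ) * ∑ d ∈ Icc 1 (x.factorization p), Real.log p * (g x - g (x / p ^ d)) ^ 2 := by
  rw [Finset.mul_sum]
  refine Finset.sum_le_sum fun p hp => ?_
  have hp2 : 2 ≤ p := (mem_Ico.1 (mem_filter.1 hp).1).1
  have hlog : Real.log 2 ≤ Real.log p := Real.log_le_log (by norm_num) (by exact_mod_cast hp2)
  have hlog0 : 0 ≤ Real.log 2 := Real.log_nonneg (by norm_num)
  rw [Finset.mul_sum]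
  refine Finset.sum_le_sum fun x _ => ?_
  rw [← mul_assoc, mul_comm (Real.log 2), mul_assoc, Finset.mul_sum]
  refine mul_le_mul_of_nonneg_left (Finset.sum_le_sum fun d _ => ?_) (by positivity)
  exact mul_le_mul_of_nonneg_right hlog (sq_nonneg _)

/-- **PROPOSITION T (CONTINUUM-LIMIT §24.3) in the kernel.**  If the ROOM form is bounded by `B` times the
Dirichlet form `D(g)` (prime-power form), then
`log 2 · Σ_{x≤M}(1/x)(g x − ḡ)² ≤ ((1+θ) + (1+1/θ)·B·log 2)·D(g)`, i.e. `Var_π ≤ ((1+θ)/log 2 + (1+1/θ)B)·Ẽ`: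
a bound `ROOM ≤ B·D` uniform in `M` (the window law, CONJECTURE W of §24) is a uniform Poincaré inequality. -/
theorem variance_le_of_room_le (M : ℕ) (g : ℕ → ℝ) {θ B : ℝ} (hθ : 0 < θ)
    (hroom : ∑ p ∈ (Ico 2 (M + 1)).filter Nat.Prime,
        ∑ u ∈ (Icc 1 M).image (fun x => roughPart (p + 1) x),
          ∑ v ∈ ((Icc 1 M).filter (fun y => roughPart (p + 1) y = u)).image (fun a => a.factorization p),
            ∑ w ∈ ((Icc 1 M).filter (fun y => roughPart (p + 1) y = u)).image (fun a => a.factorization p)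
              with w < v,
              (∑ a ∈ ((Icc 1 M).filter (fun y => roughPart (p + 1) y = u)) with a.factorization p = v,
                  1 / (a : ℝ)) *
                ((∑ a ∈ ((Icc 1 M).filter (fun y => roughPart (p + 1) y = u)) with a.factorization p = w,
                      1 / (a : ℝ) * g a) /
                    (∑ a ∈ ((Icc 1 M).filter (fun y => roughPart (p + 1) y = u)) with a.factorization p = w,
                      1 / (a : ℝ)) -
                  (∑ a ∈ (((Icc 1 M).filter (fun y => roughPart (p + 1) y = u)).filter
                      (fun a => a.factorization p = w)) with
                        a * p ^ (v - w) ∈ (Icc 1 M).filter (fun y => roughPart (p + 1) y = u),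
                      1 / (a : ℝ) * g a) /
                    (∑ a ∈ (((Icc 1 M).filter (fun y => roughPart (p + 1) y = u)).filter
                      (fun a => a.factorization p = w)) with
                        a * p ^ (v - w) ∈ (Icc 1 M).filter (fun y => roughPart (p + 1) y = u),
                      1 / (a : ℝ))) ^ 2 ≤
      B * ∑ p ∈ (Ico 2 (M + 1)).filter Nat.Prime,
        ∑ x ∈ Icc 1 M, 1 / (x : ℝ) * ∑ d ∈ Icc 1 (x.factorization p), Real.log p * (g x - g (x / p ^ d)) ^ 2) :
    Real.log 2 * ∑ x ∈ Icc 1 M, 1 / (x : ℝ) *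
        (g x - (∑ y ∈ Icc 1 M, 1 / (y : ℝ) * g y) / (∑ y ∈ Icc 1 M, 1 / (y : ℝ))) ^ 2 ≤
      ((1 + θ) + (1 + 1 / θ) * B * Real.log 2) *
        ∑ p ∈ (Ico 2 (M + 1)).filter Nat.Prime,
          ∑ x ∈ Icc 1 M, 1 / (x : ℝ) * ∑ d ∈ Icc 1 (x.factorization p), Real.log p * (g x - g (x / p ^ d)) ^ 2 := by
  have h1 := variance_le_main_add_room M g hθ
  have h2 := log_two_mul_main_le_dirichlet M g
  have hlog0 : 0 < Real.log 2 := Real.log_pos (by norm_num)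
  have hθ' : 0 ≤ 1 + 1 / θ := by positivity
  have h3 := mul_le_mul_of_nonneg_left hroom (mul_nonneg hθ' hlog0.le)
  have h4 := mul_le_mul_of_nonneg_left h1 hlog0.le
  nlinarith [h2, h3, h4]

/-- **THEOREM P₀'s transfer structure in the kernel.**  If, for every prime `p ≤ M` and every atom
`A_u = {x ≤ M : roughPart (p+1) x = u}`, the atom's ROOM term is at most `s p` times the atom's own Dirichlet form
(deaths by the primes `< p` inside the atom), then
`log 2 · Σ_{x≤M}(1/x)(g x − ḡ)² ≤ ((1+θ) + (1+1/θ)·(Σ_{p≤M} s p)·log 2)·D(g)` — the large primes enter only through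
the numbers `s p` (CONTINUUM-LIMIT §24.4: `s p = max_R S_p(R)`, a convergent series under the window law). -/
theorem variance_le_of_atom_room_le (M : ℕ) (g : ℕ → ℝ) {θ : ℝ} (hθ : 0 < θ) (s : ℕ → ℝ)
    (hs : ∀ p, 0 ≤ s p)
    (hcell : ∀ p ∈ (Ico 2 (M + 1)).filter Nat.Prime, ∀ u ∈ (Icc 1 M).image (fun x => roughPart (p + 1) x),
      ∑ v ∈ ((Icc 1 M).filter (fun y => roughPart (p + 1) y = u)).image (fun a => a.factorization p),
            ∑ w ∈ ((Icc 1 M).filter (fun y => roughPart (p + 1) y = u)).image (fun a => a.factorization p)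
              with w < v,
              (∑ a ∈ ((Icc 1 M).filter (fun y => roughPart (p + 1) y = u)) with a.factorization p = v,
                  1 / (a : ℝ)) *
                ((∑ a ∈ ((Icc 1 M).filter (fun y => roughPart (p + 1) y = u)) with a.factorization p = w,
                      1 / (a : ℝ) * g a) /
                    (∑ a ∈ ((Icc 1 M).filter (fun y => roughPart (p + 1) y = u)) with a.factorization p = w,
                      1 / (a : ℝ)) -
                  (∑ a ∈ (((Icc 1 M).filter (fun y => roughPart (p + 1) y = u)).filter
                      (fun a => a.factorization p = w)) with
                        a * p ^ (v - w) ∈ (Icc 1 M).filter (fun y => roughPart (p + 1) y = u),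
                      1 / (a : ℝ) * g a) /
                    (∑ a ∈ (((Icc 1 M).filter (fun y => roughPart (p + 1) y = u)).filter
                      (fun a => a.factorization p = w)) with
                        a * p ^ (v - w) ∈ (Icc 1 M).filter (fun y => roughPart (p + 1) y = u),
                      1 / (a : ℝ))) ^ 2 ≤
        s p * ∑ x ∈ (Icc 1 M).filter (fun y => roughPart (p + 1) y = u), 1 / (x : ℝ) *
          ∑ q ∈ (Ico 2 (M + 1)).filter Nat.Prime with q < p,
            ∑ d ∈ Icc 1 (x.factorization q), Real.log q * (g x - g (x / q ^ d)) ^ 2) :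
    Real.log 2 * ∑ x ∈ Icc 1 M, 1 / (x : ℝ) *
        (g x - (∑ y ∈ Icc 1 M, 1 / (y : ℝ) * g y) / (∑ y ∈ Icc 1 M, 1 / (y : ℝ))) ^ 2 ≤
      ((1 + θ) + (1 + 1 / θ) * (∑ p ∈ (Ico 2 (M + 1)).filter Nat.Prime, s p) * Real.log 2) *
        ∑ p ∈ (Ico 2 (M + 1)).filter Nat.Prime,
          ∑ x ∈ Icc 1 M, 1 / (x : ℝ) * ∑ d ∈ Icc 1 (x.factorization p), Real.log p * (g x - g (x / p ^ d)) ^ 2 := by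
  set P := (Ico 2 (M + 1)).filter Nat.Prime with hP
  set D : ℝ := ∑ p ∈ P, ∑ x ∈ Icc 1 M, 1 / (x : ℝ) *
    ∑ d ∈ Icc 1 (x.factorization p), Real.log p * (g x - g (x / p ^ d)) ^ 2 with hD
  -- the atoms' internal forms sum to D_{<p} ≤ D
  have hinner_nonneg : ∀ x q : ℕ, 0 ≤ 1 / (x : ℝ) *
      ∑ d ∈ Icc 1 (x.factorization q), Real.log q * (g x - g (x / q ^ d)) ^ 2 := by
    intro x q
    refine mul_nonneg (by positivity) (Finset.sum_nonneg fun d _ => mul_nonneg ?_ (sq_nonneg _))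
    exact Real.log_natCast_nonneg q
  have hDlt : ∀ p ∈ P, ∑ x ∈ Icc 1 M, 1 / (x : ℝ) * ∑ q ∈ P with q < p,
      ∑ d ∈ Icc 1 (x.factorization q), Real.log q * (g x - g (x / q ^ d)) ^ 2 ≤ D := by
    intro p _
    rw [hD, Finset.sum_comm]
    simp_rw [Finset.mul_sum]
    refine Finset.sum_le_sum fun x _ => ?_
    refine Finset.sum_le_sum_of_subset_of_nonneg (Finset.filter_subset _ _) fun q _ _ => ?_
    rw [← Finset.mul_sum]
    exact hinner_nonneg x q
  refine variance_le_of_room_le M g hθ ?_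
  -- ROOM ≤ (Σ s p) · D
  have hmapsU : ∀ p, ∀ x ∈ Icc 1 M, roughPart (p + 1) x ∈ (Icc 1 M).image (fun x => roughPart (p + 1) x) :=
    fun p x hx => mem_image_of_mem _ hx
  calc _ ≤ ∑ p ∈ P, s p * ∑ x ∈ Icc 1 M, 1 / (x : ℝ) * ∑ q ∈ P with q < p,
            ∑ d ∈ Icc 1 (x.factorization q), Real.log q * (g x - g (x / q ^ d)) ^ 2 := by
        refine Finset.sum_le_sum fun p hp => ?_
        rw [← Finset.sum_fiberwise_of_maps_to (hmapsU p) (fun x => 1 / (x : ℝ) * ∑ q ∈ P with q < p,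
            ∑ d ∈ Icc 1 (x.factorization q), Real.log q * (g x - g (x / q ^ d)) ^ 2), Finset.mul_sum]
        exact Finset.sum_le_sum fun u hu => hcell p hp u hu
    _ ≤ ∑ p ∈ P, s p * D := Finset.sum_le_sum fun p hp => mul_le_mul_of_nonneg_left (hDlt p hp) (hs p)
    _ = (∑ p ∈ P, s p) * D := by rw [Finset.sum_mul]

end Summit.RiemannHypothesis.RiemannHypothesis.Theorems.IntegerScrew

end
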